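import Summits.AtomisticToContinuum.Crystallization.Theorems.CoarseGrains.Negative.PredicateAPI

/-!
# `CoarseGrains` / Negative: minimality and largeness are load-bearing; no `N₀` uniform in `R`

Negative knowledge for crux `stmt-AtomisticToContinuum-9331` (`ExcessDecayLiouville.CoarseGrains`),
standing crux-disprover seat `refuter-cdisprove-stmt-AtomisticToContinuum-9331-0` (2026-08-16); builds
on `Negative.PredicateAPI`.  Nothing here closes an item; no theorem concludes a Theses decl.

* `succ_le_card_of_near`: a two-way `1/40`-matched ball of radius `≥ 11/10 + K` needs `K + 1` particles
  (the sites `t 0 + A (z₀ + n u)`, `n ≤ K`, lie in the ball and are `≥ 189/200` apart).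
* `coarseGrains_false_without_minimality`: with `IsGroundState` weakened to `Injective` the crux fails at
  `R = 3` (collinear gas spaced `10`) — any proof must use minimality.
* `coarseGrains_false_without_largeness`: with `N ≥ N₀` dropped it fails at `R = 2` (the empty ground
  state, `isGroundState_fin_zero`) — any proof must use largeness; quantitatively
  `coarseGrains_threshold_lower_bound`: `N₀(R) > R − 21/10`.
* `not_coarseGrains_uniform`: the quantifier swap `∃ N₀ ∀ R` is false
  (`LennardJonesGroundStatesExist_holds`).
-/

noncomputable section

open Literature.MathematicalPhysics.StatisticalMechanics

namespace Summit.AtomisticToContinuum.Crystallization.Theorems.CoarseGrains.Negative.LoadBearing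

open Summit.AtomisticToContinuum.Crystallization.Theorems.CoarseGrains.Negative.PredicateAPI

/-! ### Counting: a matched ball of radius `R ≥ 11/10 + K` needs `K + 1` distinct particles -/

/-- If `B_R(c)` is two-way `1/40`-matched and `11/10 + K ≤ R`, the configuration has at least `K + 1`
particles: the sites `t 0 + A (z₀ + n u)`, `n = 0, …, K`, lie in the ball, are pairwise `≥ 189/200` apart,
and each owns a particle within `1/40`. -/
theorem succ_le_card_of_near {N : ℕ} {x : Fin N → E3} {c : E3} {R : ℝ} {t : Fin 2 → E3}
    {A : E3 →L[ℝ] E3} (hA : Adm A) (hN : Near (Set.range x) c R t A (1 / 40)) (K : ℕ)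
    (hR : 11 / 10 + K ≤ R) : K + 1 ≤ N := by
  obtain ⟨z₀, hz₀, hz₀c⟩ := exists_site_near hA (t 0) c
  set u : E3 := triangularVec₁ 1 with hu
  have hAu : ‖A u‖ ≤ 199 / 200 := by simpa [hu, norm_triangularVec₁] using adm_norm_le hA u
  -- the sites
  let s : Fin (K + 1) → E3 := fun n => t 0 + A (z₀ + ((n : ℕ) : ℝ) • u)
  have hs_mem : ∀ n : Fin (K + 1), z₀ + ((n : ℕ) : ℝ) • u ∈ Lam := fun n =>
    lam_add_mem hz₀ (lam_nsmul_mem n triangularVec₁_mem_lam)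
  have hs_ball : ∀ n : Fin (K + 1), dist (s n) c ≤ R := by
    intro n
    have hn : ((n : ℕ) : ℝ) ≤ K := by exact_mod_cast Nat.lt_succ_iff.1 n.2
    have h1 : dist (s n) (t 0 + A z₀) = ‖A (((n : ℕ) : ℝ) • u)‖ := by
      rw [dist_site_site]; congr 1; abel_nf
    have h2 : ‖A (((n : ℕ) : ℝ) • u)‖ ≤ (n : ℕ) * (199 / 200) := by
      rw [map_smul, norm_smul, Real.norm_eq_abs, abs_of_nonneg (by positivity)]
      exact mul_le_mul_of_nonneg_left hAu (by positivity)
    calc dist (s n) c ≤ dist (s n) (t 0 + A z₀) + dist (t 0 + A z₀) c := dist_triangle _ _ _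
      _ ≤ (n : ℕ) * (199 / 200) + 11 / 10 := by rw [h1]; linarith
      _ ≤ R := by nlinarith
  -- each site owns a particle
  have hown : ∀ n : Fin (K + 1), ∃ i : Fin N, dist (x i) (s n) ≤ 1 / 40 := by
    intro n
    obtain ⟨p, ⟨i, rfl⟩, hp⟩ := hN.2 0 _ (hs_mem n) (hs_ball n)
    exact ⟨i, hp⟩
  choose f hf using hown
  have hinj : Function.Injective f := by
    intro n m hnm
    by_contra hne
    have hne' : (z₀ + ((n : ℕ) : ℝ) • u) ≠ z₀ + ((m : ℕ) : ℝ) • u := by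
      intro h
      have h' : ((n : ℕ) : ℝ) • u = ((m : ℕ) : ℝ) • u := add_left_cancel h
      have hu0 : u ≠ 0 := by
        intro h0; have := norm_triangularVec₁; rw [← hu, h0, norm_zero] at this; norm_num at this
      have := smul_left_injective ℝ hu0 h'
      exact hne (Fin.ext (by exact_mod_cast this))
    have hfar := le_dist_site_of_ne hA (t 0) (hs_mem n) (hs_mem m) hne'
    have hclose : dist (s n) (s m) ≤ 1 / 40 + 1 / 40 := by
      calc dist (s n) (s m) ≤ dist (s n) (x (f n)) + dist (x (f n)) (s m) := dist_triangle _ _ _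
        _ ≤ 1 / 40 + 1 / 40 := by
          gcongr
          · rw [dist_comm]; exact hf n
          · rw [hnm]; exact hf m
    change 189 / 200 ≤ dist (s n) (s m) at hfar
    linarith
  simpa using Fintype.card_le_of_injective f hinj

/-! ## (a) Load-bearing hypotheses: any proof must use MINIMALITY and LARGENESS -/

/-- `CoarseGrains` with the ground-state hypothesis weakened to mere injectivity (all finite
configurations of distinct points). -/
def CoarseGrainsWithoutMinimality : Prop :=
  ∀ R : ℝ, 0 < R → ∃ N₀ : ℕ, ∀ N : ℕ, N₀ ≤ N → ∀ x : Fin N → E3, Function.Injective x →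
    ∃ (c : E3) (t : Fin 2 → E3) (A : E3 →L[ℝ] E3), Adm A ∧ Inner t A ∧ Near (Set.range x) c R t A (1 / 40)

/-- **Minimality is load-bearing.** A "gas" of `N` collinear particles spaced `10` apart is injective for
every `N` but contains no matched ball of radius `3`: two adjacent sites of any admissible datum in the
ball are `≤ 199/200 + 1/20 < 10` apart yet `≥ 189/200 > 1/20` apart, so they need two distinct particles
at distance `< 10`. [folklore] -/
theorem coarseGrains_false_without_minimality : ¬ CoarseGrainsWithoutMinimality := by
  intro h
  obtain ⟨N₀, hN₀⟩ := h 3 (by norm_num)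
  set u : E3 := triangularVec₁ 1 with hu
  let x : Fin N₀ → E3 := fun i => ((10 : ℝ) * (i : ℕ)) • u
  have hu1 : ‖u‖ = 1 := norm_triangularVec₁
  have hu0 : u ≠ 0 := by intro h0; rw [h0, norm_zero] at hu1; norm_num at hu1
  have hxinj : Function.Injective x := by
    intro i j hij
    have h1 : (10 : ℝ) * (i : ℕ) = 10 * (j : ℕ) := smul_left_injective ℝ hu0 hij
    exact Fin.ext (by exact_mod_cast (mul_left_cancel₀ (by norm_num : (10 : ℝ) ≠ 0) h1))
  have hxfar : ∀ i j : Fin N₀, i ≠ j → 10 ≤ dist (x i) (x j) := by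
    intro i j hij
    have hij' : (i : ℕ) ≠ (j : ℕ) := Fin.val_ne_of_ne hij
    have h1 : (1 : ℝ) ≤ |((i : ℕ) : ℝ) - ((j : ℕ) : ℝ)| := by
      rcases Nat.lt_or_gt_of_ne hij' with hlt | hlt
      · have : ((i : ℕ) : ℝ) + 1 ≤ ((j : ℕ) : ℝ) := by exact_mod_cast hlt
        rw [abs_sub_comm]; exact le_trans (by linarith) (le_abs_self _)
      · have : ((j : ℕ) : ℝ) + 1 ≤ ((i : ℕ) : ℝ) := by exact_mod_cast hlt
        exact le_trans (by linarith) (le_abs_self _)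
    have h2 : dist (x i) (x j) = 10 * |((i : ℕ) : ℝ) - ((j : ℕ) : ℝ)| := by
      change dist (((10 : ℝ) * (i : ℕ)) • u) (((10 : ℝ) * (j : ℕ)) • u) = _
      rw [dist_eq_norm, ← sub_smul, norm_smul, hu1, mul_one, ← mul_sub, Real.norm_eq_abs, abs_mul,
        abs_of_pos (by norm_num : (0 : ℝ) < 10)]
    rw [h2]; linarith
  obtain ⟨c, t, A, hA, -, hN⟩ := hN₀ N₀ le_rfl x hxinj
  -- two adjacent sites in the ball
  obtain ⟨z, hz, hzc⟩ := exists_site_near hA (t 0) c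
  have hzu : z + u ∈ Lam := lam_add_mem hz triangularVec₁_mem_lam
  have hAu : ‖A u‖ ≤ 199 / 200 := by simpa [hu1] using adm_norm_le hA u
  have hd : dist (t 0 + A (z + u)) (t 0 + A z) = ‖A u‖ := by
    rw [dist_site_site]; congr 1; abel_nf
  have hzuc : dist (t 0 + A (z + u)) c ≤ 3 := by
    calc dist (t 0 + A (z + u)) c ≤ dist (t 0 + A (z + u)) (t 0 + A z) + dist (t 0 + A z) c :=
          dist_triangle _ _ _
      _ ≤ 199 / 200 + 11 / 10 := by rw [hd]; linarith
      _ ≤ 3 := by norm_num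
  obtain ⟨p, ⟨i, rfl⟩, hp⟩ := hN.2 0 z hz (by linarith)
  obtain ⟨q, ⟨j, rfl⟩, hq⟩ := hN.2 0 (z + u) hzu hzuc
  by_cases hij : i = j
  · subst hij
    have hfar : 189 / 200 ≤ dist (t 0 + A z) (t 0 + A (z + u)) :=
      le_dist_site_of_ne hA (t 0) hz hzu (by
        intro h; apply hu0; have := congrArg (· - z) h; simpa using this.symm)
    have hclose : dist (t 0 + A z) (t 0 + A (z + u)) ≤ 1 / 40 + 1 / 40 := by
      calc _ ≤ dist (t 0 + A z) (x i) + dist (x i) (t 0 + A (z + u)) := dist_triangle _ _ _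
        _ ≤ 1 / 40 + 1 / 40 := by rw [dist_comm]; gcongr
    linarith
  · have h10 := hxfar i j hij
    have hclose : dist (x i) (x j) ≤ 1 / 40 + 199 / 200 + 1 / 40 := by
      calc dist (x i) (x j) ≤ dist (x i) (t 0 + A z) + dist (t 0 + A z) (t 0 + A (z + u)) +
            dist (t 0 + A (z + u)) (x j) := dist_triangle4 _ _ _ _
        _ ≤ 1 / 40 + 199 / 200 + 1 / 40 := by
          gcongr
          · rw [dist_comm, hd]; exact hAu
          · rw [dist_comm]; exact hq
    linarith

/-- `CoarseGrains` with the largeness hypothesis `N ≥ N₀` dropped (every ground state, every `N`). -/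
def CoarseGrainsWithoutLargeness : Prop :=
  ∀ R : ℝ, 0 < R → ∀ (N : ℕ) (x : Fin N → E3), IsGroundState lennardJones x →
    ∃ (c : E3) (t : Fin 2 → E3) (A : E3 →L[ℝ] E3), Adm A ∧ Inner t A ∧ Near (Set.range x) c R t A (1 / 40)

/-- The empty configuration is a Lennard-Jones ground state (`E(0) = 0`). [folklore] -/
theorem isGroundState_fin_zero (x : Fin 0 → E3) : IsGroundState lennardJones x := by
  refine ⟨fun i => i.elim0, ?_⟩
  haveI : Nonempty {y : Fin 0 → E3 // Function.Injective y} := ⟨⟨x, fun i => i.elim0⟩⟩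
  unfold groundStateEnergy
  simp [interactionEnergy_of_subsingleton]

/-- **Largeness is load-bearing** (degenerate witness): the EMPTY configuration is a ground state with
no particle to own the site that every admissible datum has within `11/10` of any centre; more
generally `succ_le_card_of_near` shows `N₀(R) > R − 11/10` is forced. [folklore] -/
theorem coarseGrains_false_without_largeness : ¬ CoarseGrainsWithoutLargeness := by
  intro h
  obtain ⟨c, t, A, hA, -, hN⟩ := h 2 (by norm_num) 0 (fun i => i.elim0) (isGroundState_fin_zero _)
  have := succ_le_card_of_near hA hN 0 (by norm_num)
  omega

/-! ## (c) Natural strengthenings refuted -/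

/-- **No `N₀` uniform in `R`.** The strengthening `∃ N₀ ∀ R` of the crux (`∀ R ∃ N₀`) is false: a ground
state of `N₀` particles (exists, `LennardJonesGroundStatesExist_holds`) cannot fill a matched ball of
radius `11/10 + N₀`, which needs `N₀ + 1` particles (`succ_le_card_of_near`). [folklore] -/
theorem not_coarseGrains_uniform :
    ¬ ∃ N₀ : ℕ, ∀ R : ℝ, 0 < R → ∀ N : ℕ, N₀ ≤ N → ∀ x : Fin N → E3,
      IsGroundState lennardJones x →
      ∃ (c : E3) (t : Fin 2 → E3) (A : E3 →L[ℝ] E3), Adm A ∧ Inner t A ∧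
        Near (Set.range x) c R t A (1 / 40) := by
  rintro ⟨N₀, h⟩
  obtain ⟨x, hx⟩ := LennardJonesGroundStatesExist_holds N₀
  obtain ⟨c, t, A, hA, -, hN⟩ := h (11 / 10 + N₀) (by positivity) N₀ le_rfl x hx
  have := succ_le_card_of_near hA hN N₀ le_rfl
  omega

/-- Quantitative form: in `CoarseGrains`, any admissible `N₀(R)` exceeds `R − 11/10 − 1`
(ground states of every size exist). [folklore] -/
theorem coarseGrains_threshold_lower_bound {R : ℝ} {N₀ : ℕ}
    (h : ∀ N : ℕ, N₀ ≤ N → ∀ x : Fin N → E3, IsGroundState lennardJones x →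
      ∃ (c : E3) (t : Fin 2 → E3) (A : E3 →L[ℝ] E3), Adm A ∧ Inner t A ∧
        Near (Set.range x) c R t A (1 / 40)) :
    R - 11 / 10 < N₀ := by
  by_contra hR
  push Not at hR
  obtain ⟨x, hx⟩ := LennardJonesGroundStatesExist_holds N₀
  obtain ⟨c, t, A, hA, -, hN⟩ := h N₀ le_rfl x hx
  have := succ_le_card_of_near hA hN N₀ (by linarith)
  omega


/-! ## (b) Vacuity in the radius: the crux has NO content for `R < 97/200` -/

end Summit.AtomisticToContinuum.Crystallization.Theorems.CoarseGrains.Negative.LoadBearing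

end
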